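import Summits.ABC.IUTFork.Cor312SoundInputTwoObjects
import Summits.ABC.IUTFork.Cor312IdentifiedCopies
import HarnessLib

/-!
# [IUTchIII] Cor. 3.12 — the (pilot-level) identified-copies reading does NOT imply GapA (`SoundAtInput`)

Record-only file (D-0012) of the abc-iut cell (WAVE-5 prover seat abc-iut-w5-d236; companion of
`Cor312SoundInputWitness` / `Cor312SoundInputTwoObjects`; evidence on the optional (G4) contact of `HOME/plan/ADJUDICATION-SPEC.md` §2 between Team R's reading `Cor312.Setting.IdentifiedReading` (`Cor312IdentifiedCopies`,
seat abc-iut-c312-14) and Team A's gap statement of record `Cor312Vol.SoundAtInput` (`Cor312SoundInput`,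
seat abc-iut-c312-9)); TAKES NO SIDE.

Over Team A's typed-Theorem-3.11 situation `GapWitness.gapFull` (toy carriers: `l⋇ = 2`, one place,
nontrivial `ℚ`-packets, hull frame `{{0}, univ}`, log-volume `−2` inside `{0}` and `−1` outside):

* `idTwoSetting` — TWO objects (`Cor312SoundInputTwoObjects.boolSig`): every Θ-side Kummer image (of either
  object) and the `q`-pilot image are the NONEMPTY hull-set `{0}` (log-volume `−2`) — so Team R's
  `IdentifiedReading` (which speaks about the PILOT images only) holds — while the `q`-side image of the second
  object `false` is everything (`−1`). Then the typed Thm. 3.11 holds in full (Team A's `gapFull_statement`),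
  every bridge hypothesis and `|log(q)| > 0` hold, `IdentifiedReading` holds, but GapA FAILS for the identity
  gluing: `identifiedReading_not_imp_soundAtInput`. So a (G4) contact lemma of the shape
  `IdentifiedReading P → SoundAtInput P G` is NOT available over the frozen interfaces; what is available is
  either the one-object form (`soundAtInput_iff_statement_of_subsingleton` + `IdentifiedReading.statement`) or
  an ALL-OBJECTS identification hypothesis (Team R's `GlobalIdentifiedReading`, seat abc-iut-c312-15). The
  contentful non-vacuity of the reading itself is abc-iut-w4-d101's `Cor312IdentifiedNonVacuity.nvSetting`
  (not repeated here).

HONEST SCOPE: interface-level toys, exactly as Team A's and Team R's own witnesses; nothing here concerns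
the assembled real setting; nothing asserts or denies [IUTchIII] Cor. 3.12, Thm. 3.11, or any reading.
[claim: Mochizuki2012, status: disputed] [cite: ScholzeStix2018, §2.2 pp. 9–10]
-/

noncomputable section

namespace Summit.ABC

namespace IUTFork

namespace Cor312Vol

open Thm311 Cor312 Cor312.Checks Literature.IUT.LogThetaLattice

namespace IdentifiedWitness

open GapWitness TwoObjectWitness

/-! ## 1. Two objects: the pilot images identified, the second object unsound -/

/-- The IDENTIFIED two-object setting: `†𝒞^⊩_lgp`, `†𝒞^⊩_△` have objects `true` (the pilots) and `false`;
every Θ-side Kummer image (of either object) is `{0}` (`−2`); the `q`-side image of `true` is `{0}`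
(`−2`), of `false` is everything (`−1`). [folklore] -/
def idTwoSetting : Cor312.Setting gapSituation where
  n := 0
  HT := ℤ × ℤ
  LogLink := fun _ _ => Unit
  IsFull := fun _ => True
  lattice :=
    { theater := fun n m => (n, m)
      distinct := fun p q h => by simpa using h
      logLink := fun _ _ => ()
      logLink_full := fun _ _ => trivial }
  Frd := Unit
  IsoF := fun _ _ => Unit
  Ob := fun _ => Bool
  realify := id
  Strip := Unit
  IsoS := fun _ _ => Unit
  M := fun _ _ => Unit
  sig := boolSig
  split := { Msplit := fun _ _ => ⊤, exists_gen := fun _ _ => ⟨⟨(), trivial⟩, top_unit_isGenerator _⟩ }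
  ObΔ := Bool
  N := fun _ _ => Unit
  qData := { q := fun _ _ => (), q_gen := fun _ _ => unit_isGenerator _, objOf := fun _ => true }
  frame := fun j vQ => gapFrame _
  hul_adm := fun _ _ _ _ => trivial
  thetaRegionOf := fun _ _ _ _ => {0}
  qRegionOf := fun o' _ _ => cond o' {0} Set.univ
  qRegion_mem := fun _ _ => Set.mem_insert _ _
  qSupport_finite := fun _ => Set.toFinite _

/-- The identity gluing on objects of the identified two-object setting. [folklore] -/
def idGluing₂ : LinkGluing idTwoSetting := ⟨fun o => o, rfl⟩

/-- The identified two-object setting satisfies Team R's reading (it speaks about the pilots only).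
[folklore] -/
theorem idTwoSetting_reading : idTwoSetting.IdentifiedReading where
  kummer := fun _ _ _ => rfl
  indFixes := fun Φ _ j vQ => by
    show Φ j vQ '' ({0} : Set _) = ({0} : Set _)
    rw [Set.image_singleton, map_zero]
  hasHull := fun _ _ => trivial

/-- The (Ind3)-enlarged Θ-pilot region of the identified two-object setting is `{0}`. [folklore] -/
theorem idTwo_thetaRegion3 (j : toyIndex.Label) (vQ : toyIndex.VQ) :
    idTwoSetting.thetaRegion3 j vQ = {0} := by
  show (⋃ _ : ℤ, ({0} : Set (toyShells.Packet j vQ))) = {0}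
  exact Set.iUnion_const _

/-- The local `q`-volume of the pilot is `−2`. [folklore] -/
theorem idTwo_qLocal (j : toyIndex.Label) (vQ : toyIndex.VQ) : idTwoSetting.qLocal j vQ = -2 :=
  gapData_logvol_of_subset subset_rfl

/-- `−|log(q)| = −2` in the identified two-object setting. [folklore] -/
theorem idTwo_negLogQ : idTwoSetting.negLogQ = -2 := by
  unfold Cor312.Setting.negLogQ
  have h : ∀ i : Fin toyIndex.lstar,
      (∑ᶠ vQ : toyIndex.VQ, idTwoSetting.qLocal (Cor312.Setting.labelSucc i) vQ) = -2 := by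
    intro i
    have h1 : (fun vQ : toyIndex.VQ => idTwoSetting.qLocal (Cor312.Setting.labelSucc i) vQ) =
        fun _ => (-2 : ℝ) := by
      funext vQ
      exact idTwo_qLocal _ vQ
    rw [h1, finsum_unique]
  simp only [h]
  exact processionNormalized_const (by decide) (-2)

/-- "`|log(q)| > 0`" holds in the identified two-object setting. [folklore] -/
theorem idTwoSetting_absLogQPos : idTwoSetting.AbsLogQPos := by
  show idTwoSetting.negLogQ < 0
  rw [idTwo_negLogQ]; norm_num

/-- All bridge hypotheses hold in the identified two-object setting. [folklore] -/
theorem idTwoSetting_bridgeHyps : BridgeHyps idTwoSetting where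
  mono := fun i vQ A B _ _ hAB => gapData_logvol_mono hAB
  image_adm := fun _ _ _ _ => trivial
  image_fin := fun _ => Set.toFinite _
  hul_nonempty := fun j vQ H hH => by
    rcases hH with rfl | rfl
    · exact ⟨0, rfl⟩
    · exact ⟨0, Set.mem_univ 0⟩
  theta_nonempty := fun i vQ => by
    rw [idTwo_thetaRegion3]
    exact ⟨0, rfl⟩
  finite := idTwoSetting_reading.thetaFinite

/-- The (Ind3)-enlarged Kummer image of the second object `false` is `{0}`. [folklore] -/
theorem idTwo_thetaRegion3At_false (j : toyIndex.Label) (vQ : toyIndex.VQ) :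
    thetaRegion3At idTwoSetting false j vQ = {0} := by
  show (⋃ _ : ℤ, ({0} : Set (toyShells.Packet j vQ))) = {0}
  exact Set.iUnion_const _

/-- The possible images of `false` are exactly `{0}`. [folklore] -/
theorem idTwo_mem_possibleImagesAt_false_iff (j : toyIndex.Label) (vQ : toyIndex.VQ)
    (U : Set (toyShells.Packet j vQ)) :
    U ∈ possibleImagesAt idTwoSetting false j vQ ↔ U = {0} := by
  constructor
  · rintro ⟨Φ, -, rfl⟩
    rw [idTwo_thetaRegion3At_false, Set.image_singleton, map_zero]
    rfl
  · rintro rfl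
    exact ⟨1, (Cor312.Setting.indGroup gapSituation).one_mem, by
      rw [idTwo_thetaRegion3At_false, Set.image_singleton]; rfl⟩

/-- The union of the possible images of `false` is `{0}`. [folklore] -/
theorem idTwo_sUnion_possibleImagesAt_false (j : toyIndex.Label) (vQ : toyIndex.VQ) :
    ⋃₀ possibleImagesAt idTwoSetting false j vQ = ({0} : Set (toyShells.Packet j vQ)) := by
  ext x
  simp only [Set.mem_sUnion]
  constructor
  · rintro ⟨U, hU, hx⟩
    rwa [(idTwo_mem_possibleImagesAt_false_iff j vQ U).1 hU] at hx
  · intro hx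
    exact ⟨{0}, (idTwo_mem_possibleImagesAt_false_iff j vQ _).2 rfl, hx⟩

/-- The packet hull of `false` is `{0}`. [folklore] -/
theorem idTwo_thetaHullAt_false (j : toyIndex.Label) (vQ : toyIndex.VQ) :
    thetaHullAt idTwoSetting false j vQ = ({0} : Set (toyShells.Packet j vQ)) := by
  refine Set.Subset.antisymm ?_ ?_
  · show (gapFrame _).hull (⋃₀ possibleImagesAt idTwoSetting false j vQ) ⊆ {0}
    exact gapFrame_hull_of_subset (idTwo_sUnion_possibleImagesAt_false j vQ).le
  · exact ((idTwo_sUnion_possibleImagesAt_false j vQ).symm.le).trans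
      ((gapFrame (toyShells.Packet j vQ)).subset_hull (⋃₀ possibleImagesAt idTwoSetting false j vQ))

/-- The local Θ-volume of `false` is `−2`. [folklore] -/
theorem idTwo_thetaLocalAt_false (j : toyIndex.Label) (vQ : toyIndex.VQ) :
    thetaLocalAt idTwoSetting false j vQ = ((-2 : ℝ) : WithTop ℝ) := by
  unfold thetaLocalAt
  rw [if_pos (show HullDefinedAt idTwoSetting false j vQ from ⟨trivial, trivial⟩)]
  show ((gapData.logvol j vQ (thetaHullAt idTwoSetting false j vQ) : ℝ) : WithTop ℝ) = _
  rw [idTwo_thetaHullAt_false, gapData_logvol_of_subset subset_rfl]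

/-- `false` is `ThetaFiniteAt`. [folklore] -/
theorem idTwo_thetaFiniteAt_false : ThetaFiniteAt idTwoSetting false :=
  ⟨fun i vQ => by rw [idTwo_thetaLocalAt_false]; exact WithTop.coe_ne_top, fun _ => Set.toFinite _⟩

/-- The global Θ-side volume of the input `false` is `−2`. [folklore] -/
theorem idTwo_negLogThetaAt_false : negLogThetaAt idTwoSetting false = ((-2 : ℝ) : WithTop ℝ) := by
  unfold negLogThetaAt
  rw [if_pos idTwo_thetaFiniteAt_false]
  have h : ∀ i : Fin toyIndex.lstar,
      (∑ᶠ vQ : toyIndex.VQ,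
        (thetaLocalAt idTwoSetting false (Cor312.Setting.labelSucc i) vQ).untopD 0) = -2 := by
    intro i
    have h1 : (fun vQ : toyIndex.VQ =>
        (thetaLocalAt idTwoSetting false (Cor312.Setting.labelSucc i) vQ).untopD 0) =
        fun _ => (-2 : ℝ) := by
      funext vQ
      rw [idTwo_thetaLocalAt_false, WithTop.untopD_coe]
    rw [h1, finsum_unique]
  simp only [h]
  exact congrArg _ (processionNormalized_const (by decide) (-2))

/-- The global `q`-side volume of the object `false` of `†𝒞^⊩_△` is `−1`. [folklore] -/
theorem idTwo_negLogQAt_false : negLogQAt idTwoSetting false = -1 := by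
  unfold negLogQAt
  have h : ∀ i : Fin toyIndex.lstar,
      (∑ᶠ vQ : toyIndex.VQ, qLocalAt idTwoSetting false (Cor312.Setting.labelSucc i) vQ) = -1 := by
    intro i
    have h1 : (fun vQ : toyIndex.VQ => qLocalAt idTwoSetting false (Cor312.Setting.labelSucc i) vQ) =
        fun _ => (-1 : ℝ) := by
      funext vQ
      exact gapData_logvol_univ _ vQ
    rw [h1, finsum_unique]
  simp only [h]
  exact processionNormalized_const (by decide) (-1)

/-- GapA FAILS in the identified two-object setting for the identity gluing (at the input `false`).
[folklore] -/
theorem idTwoSetting_not_soundAtInput : ¬ SoundAtInput idTwoSetting idGluing₂ := by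
  intro h
  obtain ⟨-, hle⟩ := h false
  rw [idTwo_negLogThetaAt_false, show idGluing₂.linkMap false = false from rfl, idTwo_negLogQAt_false,
    WithTop.coe_le_coe] at hle
  norm_num at hle

/-- **THE IDENTIFIED-COPIES READING DOES NOT IMPLY GapA over the frozen interfaces**: there is an
instantiation in which the typed Theorem 3.11 holds in full, every bridge hypothesis holds, `|log(q)| > 0`,
Team R's `IdentifiedReading` holds — and Team A's `SoundAtInput` FAILS (for the exhibited gluing). The
reading constrains the PILOT images; GapA quantifies over every object of `†𝒞^⊩_lgp`. A (G4) contact lemma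
therefore needs either a one-object setting (§1) or an all-objects identification hypothesis.
Interface-level; no side taken. [folklore] -/
theorem identifiedReading_not_imp_soundAtInput :
    ∃ (T : ThetaIndex) (F : FullSituation T) (P : Cor312.Setting F.toLatticeSituation.toSituation)
      (G : LinkGluing P),
      F.Statement ∧ BridgeHyps P ∧ P.AbsLogQPos ∧ P.IdentifiedReading ∧ ¬ SoundAtInput P G :=
  ⟨toyIndex, gapFull, idTwoSetting, idGluing₂, gapFull_statement, idTwoSetting_bridgeHyps,
    idTwoSetting_absLogQPos, idTwoSetting_reading, idTwoSetting_not_soundAtInput⟩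

end IdentifiedWitness

end Cor312Vol

end IUTFork

end Summit.ABC

end
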